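import Literature.Analysis.Fourier.TitchmarshPaleyWiener
import Literature.Analysis.Convolution.CompactlySupportedConvolutionAlgebra
import Mathlib.Analysis.Calculus.ContDiff.Convolution
import Mathlib.Analysis.Calculus.BumpFunction.Convolution
import Mathlib.Analysis.Calculus.BumpFunction.InnerProduct
import Mathlib.Analysis.Complex.RealDeriv
import Mathlib.Analysis.SpecialFunctions.ExpDeriv
import Mathlib.Topology.ContinuousMap.Weierstrass
import HarnessLib

/-!
# Proof of the theorem of supports (Titchmarsh 1926, Thm. VII; Hörmander Thm. 4.3.3, `n = 1`)

This file DISCHARGES the named fact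
`Literature.Analysis.Fourier.Titchmarsh1926_convolution_support` of
`Literature/Analysis/Fourier/TitchmarshPaleyWiener.lean`:
for continuous compactly supported `f, g : ℝ → ℂ`, both `≢ 0`,
`inf supp (f ∗ g) = inf supp f + inf supp g` and `sup supp (f ∗ g) = sup supp f + sup supp g`
where `(f ∗ g)(x) = ∫ f(t) g(x − t) dt`.

We formalize HÖRMANDER'S REAL-VARIABLE PROOF of the theorem of supports
[HormanderALPDO1, Thm. 4.3.3, pp. 90–92], specialised to one variable, inside the convolution
algebra `Literature.Analysis.Convolution.ConvFun` (= `C_c(ℝ, ℂ)` with `*` = convolution, a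
`NonUnitalCommRing`; `mul_apply : (f * g) x = ∫ t, f t * g (x - t)` is literally the integrand of
the fact). Only the "sup" end is proved directly; the "inf" end follows by the reflection
`x ↦ −x`. Architecture (mirroring the printed proof):

1. (Lemma 4.3.4, in the form `‖a ∗ b̃‖₂ = ‖a ∗ b‖₂`, `b̃(x) = conj b(−x)`) from
   `‖g‖₂² = (g ∗ g̃)(0)` and commutativity/associativity — `normSqInt_mul_til`.
2. (The special case (4.3.7), `2 sup supp u ≤ sup supp (u ∗ u)`) for `u ∈ C¹_c`: Hörmander's
   chain `‖u‖₂² ≤ sup |u ∗ ũ| ≤ C ‖∂(u ∗ ũ)‖₂ = C ‖∂u ∗ u‖₂` (a one-derivative variant of his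
   Lemma 4.3.5, sufficient for `n = 1`), applied to the twists `u_ξ = e^{ξx} u`
   (`ConvFun.mulExp`), and `e^{κξ} ≲ ξ²` forcing `κ ≤ 0` — `eqOn_Ioi_of_sq_C1`.
3. (Regularisation, first paragraph of the printed proof) the same for continuous `u`, by
   mollifying with `ContDiffBump.normed` and `(u∗φ)∗(u∗φ) = (u∗u)∗(φ∗φ)` — `eqOn_Ioi_of_sq`.
4. (The `K_j` argument, p. 90–91) with `σ_j = sup ⋃_{a+b≤j} supp (x^a u) ∗ (x^b v)`:
   `2σ_j ≤ σ_{j-1} + σ_{j+1}` from `x((q₁u)∗(p₂v)) = (p₁u)∗(p₂v) + (q₁u)∗(q₂v)` and step 3, hence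
   `σ_j = σ_0` — `eqOn_Ioi_xpow_mul_xpow`.
5. (Last paragraph of the printed proof, with Weierstrass' theorem replacing the heat kernels
   `E(x − x_j, t)`) all moments of `t ↦ u(t) v(x − t)` vanish for `x > sup supp (u ∗ v)`, so it
   vanishes — `add_le_of_eqOn_Ioi`; assembly `Titchmarsh1926_convolution_support_holds`.

## References

* L. Hörmander, *The Analysis of Linear Partial Differential Operators I*, 2nd ed., Springer
  1990, Thm. 4.3.3 and Lemmas 4.3.4–4.3.5 (pp. 90–92). [HormanderALPDO1]
* E. C. Titchmarsh, *The zeros of certain integral functions*, Proc. London Math. Soc. (2) 25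
  (1926) 283–302, Thm. VII. [Titchmarsh1926]
-/

noncomputable section

open MeasureTheory Set Filter
open scoped ComplexConjugate Topology Convolution Pointwise

namespace Literature.Analysis.Fourier

namespace Titchmarsh1926

open Literature.Analysis.Convolution Literature.Analysis.Convolution.ConvFun

/-! ### §0. Complements on the convolution algebra `ConvFun` -/

/-- Every `u ∈ C_c` lives in some symmetric band `[−R, R]`, `R > 0`. [folklore] -/
theorem exists_suppIn (u : ConvFun) : ∃ R : ℝ, 0 < R ∧ SuppIn u (-R) R := by
  obtain ⟨R, hR, hsub⟩ :=
    u.hasCompactSupport.isCompact.isBounded.subset_closedBall_lt 0 (0 : ℝ)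
  refine ⟨R, hR, fun x hx => ?_⟩
  have hx' : x ∈ Metric.closedBall (0 : ℝ) R := hsub (subset_tsupport _ hx)
  rw [Metric.mem_closedBall, dist_zero_right, Real.norm_eq_abs, abs_le] at hx'
  exact hx'

/-- `u ∈ C_c` vanishes on some right half-line `(c, ∞)`. [folklore] -/
theorem exists_eqOn_Ioi (u : ConvFun) : ∃ c : ℝ, EqOn u 0 (Ioi c) := by
  obtain ⟨R, -, hR⟩ := exists_suppIn u
  exact ⟨R, fun x hx => hR.eq_zero (Or.inr hx)⟩

/-- A non-zero element takes a non-zero value somewhere. [folklore] -/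
theorem exists_ne_zero {u : ConvFun} (hu : u ≠ 0) : ∃ t, u t ≠ 0 := by
  by_contra h
  push Not at h
  exact hu (ConvFun.ext fun t => by rw [h t]; rfl)

/-- The support of an element of `C_c` is bounded above. [folklore] -/
theorem bddAbove_support (u : ConvFun) : BddAbove (Function.support (u : ℝ → ℂ)) :=
  u.hasCompactSupport.isCompact.bddAbove.mono (subset_tsupport _)

/-- The support of an element of `C_c` is bounded below. [folklore] -/
theorem bddBelow_support (u : ConvFun) : BddBelow (Function.support (u : ℝ → ℂ)) :=
  u.hasCompactSupport.isCompact.bddBelow.mono (subset_tsupport _)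

/-- `t ↦ ‖u t‖ ^ 2` is continuous. [folklore] -/
theorem continuous_norm_sq (u : ConvFun) : Continuous fun t => ‖u t‖ ^ 2 :=
  (continuous_norm.comp u.continuous).pow 2

/-- `t ↦ ‖u t‖ ^ 2` has compact support. [folklore] -/
theorem hasCompactSupport_norm_sq (u : ConvFun) : HasCompactSupport fun t => ‖u t‖ ^ 2 :=
  u.hasCompactSupport.norm.comp_left (g := fun r : ℝ => r ^ 2) (by simp)

/-- `t ↦ ‖u t‖ ^ 2` is integrable. [folklore] -/
theorem integrable_norm_sq (u : ConvFun) : Integrable (fun t => ‖u t‖ ^ 2) volume :=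
  (continuous_norm_sq u).integrable_of_hasCompactSupport (hasCompactSupport_norm_sq u)

/-- The integrand of `(u * v) x` is integrable in `t`. [folklore] -/
theorem integrable_mul_integrand (u v : ConvFun) (x : ℝ) :
    Integrable (fun t => u t * v (x - t)) volume :=
  (convolutionExists u v x).integrable.congr (Eventually.of_forall fun _ => rfl)

/-- **Reflection–conjugation** `ũ(x) = conj (u (−x))` (Hörmander's `ũ`, Lemma 4.3.4). [folklore] -/
def til (u : ConvFun) : ConvFun :=
  ConvFun.mk (fun x => conj (u (-x)))
    (Complex.continuous_conj.comp (u.continuous.comp continuous_neg))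
    (by
      refine HasCompactSupport.intro u.hasCompactSupport.isCompact.neg fun x hx => ?_
      have : u (-x) = 0 := image_eq_zero_of_notMem_tsupport fun h => hx (by simpa using h)
      simp [this])

/-- `ũ(x) = conj (u (−x))`. [folklore] -/
@[simp] theorem til_apply (u : ConvFun) (x : ℝ) : til u x = conj (u (-x)) := rfl

/-- `ũ̃ = u`. [folklore] -/
theorem til_til (u : ConvFun) : til (til u) = u := by
  ext x; simp

/-- **`‖u‖₂² = (u ∗ ũ)(0)`** (Hörmander, proof of Lemma 4.3.4).
[cite: HormanderALPDO1, Lemma 4.3.4] -/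
theorem mul_til_apply_zero (u : ConvFun) :
    (u * til u) 0 = ((∫ t, ‖u t‖ ^ 2 : ℝ) : ℂ) := by
  rw [mul_apply, ← integral_complex_ofReal]
  refine integral_congr_ae (Eventually.of_forall fun t => ?_)
  simp only [til_apply, zero_sub, neg_neg, Complex.mul_conj, Complex.normSq_eq_norm_sq,
    Complex.ofReal_pow]

/-- `(u ∗ v)~ = ũ ∗ ṽ`. [folklore] -/
theorem til_mul (u v : ConvFun) : til (u * v) = til u * til v := by
  ext x
  rw [til_apply, mul_apply, mul_apply, ← integral_conj,
    ← integral_neg_eq_self (fun t => til u t * til v (x - t)) volume]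
  refine integral_congr_ae (Eventually.of_forall fun t => ?_)
  dsimp only
  have h : -(x - -t) = -x - t := by ring
  rw [til_apply, til_apply, neg_neg, h, map_mul]

/-- The squared `L²` norm `∫ ‖u‖²`. [folklore] -/
def normSqInt (u : ConvFun) : ℝ := ∫ t, ‖u t‖ ^ 2

/-- `0 ≤ ∫ ‖u‖²`. [folklore] -/
theorem normSqInt_nonneg (u : ConvFun) : 0 ≤ normSqInt u :=
  integral_nonneg fun _ => by positivity

/-! ### §1. Lemma 4.3.4: `‖a ∗ b̃‖₂ = ‖a ∗ b‖₂` -/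

/-- **Hörmander's Lemma 4.3.4** (generalised to two factors): `∫ |a ∗ b̃|² = ∫ |a ∗ b|²`, since
both equal `(a ∗ ã ∗ b ∗ b̃)(0)` by `‖g‖₂² = (g ∗ g̃)(0)` and commutativity/associativity of
convolution. [cite: HormanderALPDO1, Lemma 4.3.4] -/
theorem normSqInt_mul_til (a b : ConvFun) : normSqInt (a * til b) = normSqInt (a * b) := by
  have h1 := mul_til_apply_zero (a * til b)
  have h2 := mul_til_apply_zero (a * b)
  rw [til_mul, til_til] at h1
  rw [til_mul] at h2
  have h3 : a * til b * (til a * b) = a * b * (til a * til b) := by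
    rw [mul_mul_mul_comm, mul_mul_mul_comm a b, mul_comm (til b) b]
  apply Complex.ofReal_injective
  change ((∫ t, ‖(a * til b) t‖ ^ 2 : ℝ) : ℂ) = ((∫ t, ‖(a * b) t‖ ^ 2 : ℝ) : ℂ)
  rw [← h1, ← h2, h3]

/-! ### §0 (continued). Multiplication by `x`, monomial weights, vanishing on half-lines -/

/-- Multiplication by the coordinate: `(x u)(x) = x · u(x)`. [folklore] -/
def mulX (u : ConvFun) : ConvFun :=
  ConvFun.mk (fun x => (x : ℂ) * u x) (Complex.continuous_ofReal.mul u.continuous)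
    u.hasCompactSupport.mul_left

/-- `(x u)(x) = x u(x)`. [folklore] -/
@[simp] theorem mulX_apply (u : ConvFun) (x : ℝ) : mulX u x = (x : ℂ) * u x := rfl

/-- **Leibniz rule for convolution**: `x (u ∗ v) = (x u) ∗ v + u ∗ (x v)` (the identity
`x_ν((q₁u₁)∗(p₂u₂)) = (p₁u₁)∗(p₂u₂) + (q₁u₁)∗(q₂u₂)` of the printed proof).
[cite: HormanderALPDO1, proof of Thm. 4.3.3] -/
theorem mulX_mul (u v : ConvFun) : mulX (u * v) = mulX u * v + u * mulX v := by
  ext x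
  rw [add_apply, mulX_apply, mul_apply, mul_apply, mul_apply, ← integral_const_mul,
    ← integral_add (integrable_mul_integrand (mulX u) v x) (integrable_mul_integrand u (mulX v) x)]
  refine integral_congr_ae (Eventually.of_forall fun t => ?_)
  simp only [mulX_apply, Complex.ofReal_sub]
  ring

/-- Monomial weights `(x^a u)(x) = x^a u(x)`. [folklore] -/
def xpow (a : ℕ) (u : ConvFun) : ConvFun :=
  ConvFun.mk (fun x => (x : ℂ) ^ a * u x) ((Complex.continuous_ofReal.pow a).mul u.continuous)
    u.hasCompactSupport.mul_left

/-- `(x^a u)(x) = x^a u(x)`. [folklore] -/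
@[simp] theorem xpow_apply (a : ℕ) (u : ConvFun) (x : ℝ) : xpow a u x = (x : ℂ) ^ a * u x := rfl

/-- `x^0 u = u`. [folklore] -/
@[simp] theorem xpow_zero (u : ConvFun) : xpow 0 u = u := by
  ext x; simp

/-- `x^{a+1} u = x (x^a u)`. [folklore] -/
theorem xpow_succ (a : ℕ) (u : ConvFun) : xpow (a + 1) u = mulX (xpow a u) := by
  ext x; simp only [xpow_apply, mulX_apply]; ring

/-- Supports add under convolution, half-line form: `u = 0` on `(a, ∞)` and `v = 0` on `(b, ∞)`
give `u ∗ v = 0` on `(a + b, ∞)` (the trivial inclusion (4.2.2)).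
[cite: HormanderALPDO1, (4.2.2)] -/
theorem eqOn_Ioi_mul {u v : ConvFun} {a b : ℝ} (hu : EqOn u 0 (Ioi a)) (hv : EqOn v 0 (Ioi b)) :
    EqOn (⇑(u * v)) 0 (Ioi (a + b)) := by
  intro x hx
  rw [mul_apply, Pi.zero_apply]
  refine integral_eq_zero_of_ae (Eventually.of_forall fun t => ?_)
  by_cases ht : a < t
  · simp [hu (mem_Ioi.mpr ht)]
  · have : b < x - t := by
      have hx' : a + b < x := hx
      push Not at ht; linarith
    simp [hv (mem_Ioi.mpr this)]

/-- Vanishing on `(a, ∞)` is inherited by larger half-lines. [folklore] -/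
theorem eqOn_Ioi_mono {u : ConvFun} {a b : ℝ} (hu : EqOn u 0 (Ioi a)) (hab : a ≤ b) :
    EqOn u 0 (Ioi b) :=
  hu.mono (Ioi_subset_Ioi hab)

/-- Sums preserve vanishing on a half-line. [folklore] -/
theorem eqOn_Ioi_add {u v : ConvFun} {a : ℝ} (hu : EqOn u 0 (Ioi a)) (hv : EqOn v 0 (Ioi a)) :
    EqOn (⇑(u + v)) 0 (Ioi a) := fun x hx => by
  rw [add_apply, hu hx, hv hx]; simp

/-- Differences preserve vanishing on a half-line. [folklore] -/
theorem eqOn_Ioi_sub {u v : ConvFun} {a : ℝ} (hu : EqOn u 0 (Ioi a)) (hv : EqOn v 0 (Ioi a)) :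
    EqOn (⇑(u - v)) 0 (Ioi a) := fun x hx => by
  rw [sub_apply, hu hx, hv hx]; simp

/-- Scalar multiples preserve vanishing on a half-line. [folklore] -/
theorem eqOn_Ioi_smul {u : ConvFun} {a : ℝ} (hu : EqOn u 0 (Ioi a)) (c : ℂ) :
    EqOn (⇑(c • u)) 0 (Ioi a) := fun x hx => by
  rw [smul_apply, hu hx]; simp

/-- Multiplication by `x` preserves vanishing on a half-line. [folklore] -/
theorem eqOn_Ioi_mulX {u : ConvFun} {a : ℝ} (hu : EqOn u 0 (Ioi a)) :
    EqOn (⇑(mulX u)) 0 (Ioi a) := fun x hx => by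
  rw [mulX_apply, hu hx]; simp

/-- Exponential twists preserve vanishing on a half-line. [folklore] -/
theorem eqOn_Ioi_mulExp {u : ConvFun} {a : ℝ} (hu : EqOn u 0 (Ioi a)) (z : ℂ) :
    EqOn (⇑(mulExp z u)) 0 (Ioi a) := fun x hx => by
  rw [mulExp_apply, hu hx]; simp

/-- The zero function vanishes on every half-line. [folklore] -/
theorem eqOn_Ioi_zero (a : ℝ) : EqOn (⇑(0 : ConvFun)) 0 (Ioi a) := fun _ _ => rfl

/-- A function vanishing on every right half-line is zero. [folklore] -/
theorem eq_zero_of_forall_eqOn_Ioi {u : ConvFun} (h : ∀ a, EqOn u 0 (Ioi a)) : u = 0 :=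
  ConvFun.ext fun x => h (x - 1) (by simp)

/-- Reflection–conjugation preserves a symmetric band. [folklore] -/
theorem suppIn_til {u : ConvFun} {R : ℝ} (h : SuppIn u (-R) R) : SuppIn (til u) (-R) R := by
  intro x hx
  rw [til_apply] at hx
  have hx' : u (-x) ≠ 0 := fun h0 => hx (by rw [h0, map_zero])
  have := h (-x) hx'
  constructor <;> linarith [this.1, this.2]

/-! ### §2. The special case (4.3.7) for `u ∈ C¹_c`:
`u ∗ u = 0` on `(b, ∞)` ⟹ `u = 0` on `(b/2, ∞)` -/

/-- Mathlib's convolution for the `ℝ`-bilinear multiplication `mul ℝ ℂ` is the convolution for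
`mul ℂ ℂ` used by `ConvFun` (same integrand). [folklore] -/
theorem convolution_mul_real_eq (f g : ℝ → ℂ) :
    (f ⋆[ContinuousLinearMap.mul ℝ ℂ, volume] g) = (f ⋆[ConvFun.L, volume] g) := by
  funext x
  simp only [convolution_def, ContinuousLinearMap.mul_apply']

/-- A function with an everywhere derivative given by an element of `C_c` is `C¹`. [folklore] -/
theorem contDiff_of_hasDerivAt {u u₁ : ConvFun} (hd : ∀ x, HasDerivAt (⇑u) (u₁ x) x) :
    ContDiff ℝ 1 (⇑u) := by
  rw [contDiff_one_iff_deriv]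
  refine ⟨fun y => (hd y).differentiableAt, ?_⟩
  have : deriv (⇑u) = ⇑u₁ := funext fun y => (hd y).deriv
  rw [this]; exact u₁.continuous

/-- **Derivative of a convolution** with a `C¹_c` left factor: `(u ∗ v)' = u' ∗ v` (Mathlib's
`HasCompactSupport.hasDerivAt_convolution_left`). [folklore] -/
theorem hasDerivAt_mul_left {u u₁ : ConvFun} (hd : ∀ x, HasDerivAt (⇑u) (u₁ x) x) (v : ConvFun)
    (x : ℝ) : HasDerivAt (⇑(u * v)) ((u₁ * v) x) x := by
  have h := u.hasCompactSupport.hasDerivAt_convolution_left (ContinuousLinearMap.mul ℝ ℂ)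
    (contDiff_of_hasDerivAt hd) v.locallyIntegrable x
  have hderiv : deriv (⇑u) = ⇑u₁ := funext fun y => (hd y).deriv
  rw [hderiv, convolution_mul_real_eq, convolution_mul_real_eq] at h
  rw [coe_mul, coe_mul]
  exact h

/-- Where a differentiable function vanishes on an open half-line, so does its derivative.
[folklore] -/
theorem eqOn_Ioi_of_hasDerivAt {u u₁ : ConvFun} (hd : ∀ x, HasDerivAt (⇑u) (u₁ x) x) {c : ℝ}
    (h : EqOn u 0 (Ioi c)) : EqOn u₁ 0 (Ioi c) := by
  intro x hx
  have h2 : HasDerivAt (⇑u) 0 x := by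
    refine (hasDerivAt_const x (0 : ℂ)).congr_of_eventuallyEq ?_
    filter_upwards [Ioi_mem_nhds (mem_Ioi.mp hx)] with y hy
    exact h hy
  exact (hd x).unique h2

/-- **Derivative of a twist**: `(e^{ξx} u)' = e^{ξx} (ξ u + u')`. [folklore] -/
theorem hasDerivAt_mulExp {u u₁ : ConvFun} (hd : ∀ x, HasDerivAt (⇑u) (u₁ x) x) (ξ : ℝ)
    (x : ℝ) : HasDerivAt (⇑(mulExp ξ u)) ((mulExp ξ ((ξ : ℂ) • u + u₁)) x) x := by
  have he : HasDerivAt (fun y : ℝ => Complex.exp ((ξ : ℂ) * y))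
      (Complex.exp ((ξ : ℂ) * x) * ξ) x := by
    have h1 : HasDerivAt (fun y : ℝ => (ξ : ℂ) * y) ((ξ : ℂ) * (1 : ℝ)) x :=
      ((hasDerivAt_id x).ofReal_comp).const_mul (ξ : ℂ)
    rw [Complex.ofReal_one, mul_one] at h1
    exact h1.cexp
  have h := he.mul (hd x)
  have h' : HasDerivAt (⇑(mulExp (ξ : ℂ) u))
      (Complex.exp ((ξ : ℂ) * x) * ξ * u x + Complex.exp ((ξ : ℂ) * x) * u₁ x) x := h
  refine h'.congr_deriv ?_
  rw [mulExp_apply, add_apply, smul_apply]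
  ring

/-- **`|F(0)| ≤ ∫ |F'|` for `F ∈ C¹_c`** (fundamental theorem of calculus from a point to the
left of the support). [folklore] -/
theorem norm_apply_zero_le {F F₁ : ConvFun} (hd : ∀ x, HasDerivAt (⇑F) (F₁ x) x) :
    ‖F 0‖ ≤ ∫ x, ‖F₁ x‖ := by
  obtain ⟨R, hR, hF⟩ := exists_suppIn F
  have hFa : F (-(R + 1)) = 0 := hF.eq_zero (Or.inl (by linarith))
  have hftc : ∫ y in (-(R + 1))..0, F₁ y = F 0 - F (-(R + 1)) :=
    intervalIntegral.integral_eq_sub_of_hasDerivAt (fun y _ => hd y)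
      (F₁.continuous.intervalIntegrable _ _)
  rw [hFa, sub_zero] at hftc
  rw [← hftc]
  calc ‖∫ y in (-(R + 1))..0, F₁ y‖ ≤ ∫ y in (-(R + 1))..0, ‖F₁ y‖ :=
        intervalIntegral.norm_integral_le_integral_norm (by linarith)
    _ = ∫ y in Ioc (-(R + 1)) 0, ‖F₁ y‖ := intervalIntegral.integral_of_le (by linarith)
    _ ≤ ∫ y, ‖F₁ y‖ :=
        setIntegral_le_integral F₁.integrable.norm (Eventually.of_forall fun _ => norm_nonneg _)

/-- **`(∫ |g|)² ≤ 2S ∫ |g|²` for `g` living in `[−S, S]`** (Cauchy–Schwarz, by completing the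
square `2λ|g| ≤ λ² 1_{[−S,S]} + |g|²`). [folklore] -/
theorem sq_integral_norm_le {g : ConvFun} {S : ℝ} (hS : 0 < S) (hg : SuppIn g (-S) S) :
    (∫ x, ‖g x‖) ^ 2 ≤ 2 * S * normSqInt g := by
  set A := ∫ x, ‖g x‖ with hA
  have hN0 : 0 ≤ normSqInt g := normSqInt_nonneg g
  have key : ∀ lam : ℝ, 2 * lam * A ≤ 2 * S * lam ^ 2 + normSqInt g := by
    intro lam
    have hind : Integrable (indicator (Icc (-S) S) fun _ => lam ^ 2) volume :=
      (integrableOn_const (by simp)).integrable_indicator measurableSet_Icc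
    have h1 : ∫ x, 2 * lam * ‖g x‖ ≤
        ∫ x, (indicator (Icc (-S) S) (fun _ => lam ^ 2) x + ‖g x‖ ^ 2) := by
      refine integral_mono (g.integrable.norm.const_mul _) (hind.add (integrable_norm_sq g))
        fun x => ?_
      dsimp only
      by_cases hx : x ∈ Icc (-S) S
      · rw [indicator_of_mem hx]; exact two_mul_le_add_sq lam ‖g x‖
      · have : g x = 0 := by
          by_contra hne
          exact hx (hg x hne)
        rw [indicator_of_notMem hx, this, norm_zero]; simp
    have h2 : ∫ x, (indicator (Icc (-S) S) (fun _ => lam ^ 2) x + ‖g x‖ ^ 2) =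
        2 * S * lam ^ 2 + normSqInt g := by
      rw [integral_add hind (integrable_norm_sq g), integral_indicator_const _ measurableSet_Icc,
        Real.volume_real_Icc_of_le (by linarith), smul_eq_mul, normSqInt]
      ring
    have h3 : ∫ x, 2 * lam * ‖g x‖ = 2 * lam * A := integral_const_mul _ _
    linarith
  have hl : 2 * S * (A / (2 * S)) ^ 2 = A / (2 * S) * A := by
    field_simp
  have h4 := key (A / (2 * S))
  rw [hl] at h4
  have h5 : A / (2 * S) * A ≤ normSqInt g := by linarith
  rw [div_mul_eq_mul_div, div_le_iff₀ (by positivity)] at h5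
  calc A ^ 2 = A * A := sq A
    _ ≤ normSqInt g * (2 * S) := h5
    _ = 2 * S * normSqInt g := by ring

/-- **Lower bound for a twisted norm**: if `‖u‖ ≥ c ≥ 0` on `[x₁ − δ, x₁ + δ]` and `ξ ≥ 0` then
`e^{2ξ(x₁−δ)} c² 2δ ≤ ∫ |e^{ξt} u(t)|² dt`. [folklore] -/
theorem normSqInt_mulExp_ge {u : ConvFun} {x₁ δ c ξ : ℝ} (hδ : 0 < δ) (hc : 0 ≤ c) (hξ : 0 ≤ ξ)
    (h : ∀ t ∈ Icc (x₁ - δ) (x₁ + δ), c ≤ ‖u t‖) :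
    Real.exp (ξ * (x₁ - δ)) ^ 2 * (c ^ 2 * (2 * δ)) ≤ normSqInt (mulExp ξ u) := by
  have hint := integrable_norm_sq (mulExp ξ u)
  calc Real.exp (ξ * (x₁ - δ)) ^ 2 * (c ^ 2 * (2 * δ))
      = Real.exp (ξ * (x₁ - δ)) ^ 2 * c ^ 2 * volume.real (Icc (x₁ - δ) (x₁ + δ)) := by
        rw [Real.volume_real_Icc_of_le (by linarith)]; ring
    _ ≤ ∫ t in Icc (x₁ - δ) (x₁ + δ), ‖mulExp ξ u t‖ ^ 2 := by
        refine setIntegral_ge_of_const_le_real measurableSet_Icc (by simp) (fun t ht => ?_)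
          hint.integrableOn
        rw [mulExp_apply, norm_mul, mul_pow, Complex.norm_exp, ← Complex.ofReal_mul,
          Complex.ofReal_re]
        refine mul_le_mul ?_ (pow_le_pow_left₀ hc (h t ht) 2) (by positivity) (by positivity)
        refine pow_le_pow_left₀ (by positivity) (Real.exp_le_exp.mpr ?_) 2
        exact mul_le_mul_of_nonneg_left ht.1 hξ
    _ ≤ normSqInt (mulExp ξ u) :=
        setIntegral_le_integral hint (Eventually.of_forall fun _ => by positivity)

/-- **Upper bound for a twisted norm**: if `w = 0` on `(b, ∞)` and `ξ ≥ 0` then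
`∫ |e^{ξx} w|² ≤ e^{2ξb} ∫ |w|²`. [folklore] -/
theorem normSqInt_mulExp_le {w : ConvFun} {b ξ : ℝ} (hξ : 0 ≤ ξ) (hw : EqOn w 0 (Ioi b)) :
    normSqInt (mulExp ξ w) ≤ Real.exp (ξ * b) ^ 2 * normSqInt w := by
  unfold normSqInt
  rw [← integral_const_mul]
  refine integral_mono (integrable_norm_sq _) ((integrable_norm_sq w).const_mul _) fun x => ?_
  dsimp only
  rw [mulExp_apply, norm_mul, mul_pow, Complex.norm_exp, ← Complex.ofReal_mul, Complex.ofReal_re]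
  by_cases hx : b < x
  · have : w x = 0 := hw hx
    rw [this, norm_zero]; simp
  · push Not at hx
    refine mul_le_mul_of_nonneg_right ?_ (by positivity)
    exact pow_le_pow_left₀ (by positivity) (Real.exp_le_exp.mpr (mul_le_mul_of_nonneg_left hx hξ)) 2

/-- `∫ |ξ p + q|² ≤ ξ² (2 ∫ |p|² + 2 ∫ |q|²)` for `ξ ≥ 1`. [folklore] -/
theorem normSqInt_smul_add_le (p q : ConvFun) {ξ : ℝ} (hξ : 1 ≤ ξ) :
    normSqInt ((ξ : ℂ) • p + q) ≤ ξ ^ 2 * (2 * normSqInt p + 2 * normSqInt q) := by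
  have hξ0 : 0 ≤ ξ := by linarith
  unfold normSqInt
  have hI : Integrable (fun t => ξ ^ 2 * (2 * ‖p t‖ ^ 2 + 2 * ‖q t‖ ^ 2)) volume :=
    (((integrable_norm_sq p).const_mul 2).add ((integrable_norm_sq q).const_mul 2)).const_mul _
  have hE : ξ ^ 2 * ((2 * ∫ t, ‖p t‖ ^ 2) + 2 * ∫ t, ‖q t‖ ^ 2) =
      ∫ t, ξ ^ 2 * (2 * ‖p t‖ ^ 2 + 2 * ‖q t‖ ^ 2) := by
    rw [integral_const_mul, integral_add ((integrable_norm_sq p).const_mul 2)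
      ((integrable_norm_sq q).const_mul 2), integral_const_mul, integral_const_mul]
  rw [hE]
  refine integral_mono (integrable_norm_sq _) hI fun t => ?_
  dsimp only
  rw [add_apply, smul_apply]
  have h1 : ‖(ξ : ℂ) * p t + q t‖ ≤ ξ * ‖p t‖ + ‖q t‖ := by
    refine (norm_add_le _ _).trans ?_
    rw [norm_mul, Complex.norm_real, Real.norm_eq_abs, abs_of_nonneg hξ0]
  have h2 : ξ * ‖p t‖ + ‖q t‖ ≤ ξ * (‖p t‖ + ‖q t‖) := by nlinarith [norm_nonneg (q t)]
  calc ‖(ξ : ℂ) * p t + q t‖ ^ 2 ≤ (ξ * (‖p t‖ + ‖q t‖)) ^ 2 :=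
        pow_le_pow_left₀ (norm_nonneg _) (h1.trans h2) 2
    _ = ξ ^ 2 * (‖p t‖ + ‖q t‖) ^ 2 := by ring
    _ ≤ ξ ^ 2 * (2 * ‖p t‖ ^ 2 + 2 * ‖q t‖ ^ 2) := by
        refine mul_le_mul_of_nonneg_left ?_ (by positivity)
        nlinarith [sq_nonneg (‖p t‖ - ‖q t‖)]

/-- **The special case (4.3.7) of the theorem of supports for `u ∈ C¹_c`, sup end**: if
`u ∗ u = 0` on `(b, ∞)` then `u = 0` on `(b/2, ∞)`. Hörmander's proof: with `U = e^{ξx}u`,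
`F = U ∗ Ũ`, one has `(∫|U|²)² = |F(0)|² ≤ (∫|F'|)² ≤ 4R ∫|U' ∗ Ũ|² = 4R ∫|U' ∗ U|²`
(Lemma 4.3.4) `≤ 4R e^{2ξb} ξ² K₀`, while `∫|U|² ≥ m e^{2ξ(x₁−δ)}` if `u(x₁) ≠ 0`; letting
`ξ → +∞` forces `2(x₁ − δ) ≤ b`. [cite: HormanderALPDO1, Thm. 4.3.3, proof of (4.3.7)] -/
theorem eqOn_Ioi_of_sq_C1 {u u₁ : ConvFun} (hd : ∀ x, HasDerivAt (⇑u) (u₁ x) x) {b : ℝ}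
    (hb : EqOn (⇑(u * u)) 0 (Ioi b)) : EqOn u 0 (Ioi (b / 2)) := by
  intro x₁ hx₁
  by_contra hne
  have hx₁' : b / 2 < x₁ := hx₁
  have hu0 : 0 < ‖u x₁‖ := norm_pos_iff.mpr hne
  -- continuity: `‖u‖ ≥ ‖u x₁‖ / 2` on `[x₁ − δ, x₁ + δ]` with `x₁ − δ > b / 2`
  obtain ⟨δ, hδ, hδ', hlow⟩ : ∃ δ : ℝ, 0 < δ ∧ b / 2 < x₁ - δ ∧
      ∀ t ∈ Icc (x₁ - δ) (x₁ + δ), ‖u x₁‖ / 2 ≤ ‖u t‖ := by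
    obtain ⟨η, hη, hηu⟩ := Metric.continuousAt_iff.mp (u.continuous.continuousAt (x := x₁))
      (‖u x₁‖ / 2) (by positivity)
    refine ⟨min (η / 2) ((x₁ - b / 2) / 2), lt_min (by positivity) (by linarith), ?_, ?_⟩
    · have := min_le_right (η / 2) ((x₁ - b / 2) / 2); linarith
    · intro t ht
      have hle := min_le_left (η / 2) ((x₁ - b / 2) / 2)
      have hdist : dist t x₁ < η := by
        rw [Real.dist_eq, abs_lt]; constructor <;> linarith [ht.1, ht.2]
      have h := hηu hdist
      rw [dist_eq_norm] at h
      linarith [norm_sub_norm_le (u x₁) (u t), norm_sub_rev (u t) (u x₁)]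
  -- a common support band for `u` and `u₁`
  obtain ⟨R, hR, hRu, hRu₁⟩ : ∃ R : ℝ, 0 < R ∧ SuppIn u (-R) R ∧ SuppIn u₁ (-R) R := by
    obtain ⟨R₁, h₁, h₁'⟩ := exists_suppIn u
    obtain ⟨R₂, h₂, h₂'⟩ := exists_suppIn u₁
    exact ⟨max R₁ R₂, lt_max_of_lt_left h₁,
      h₁'.mono (neg_le_neg (le_max_left _ _)) (le_max_left _ _),
      h₂'.mono (neg_le_neg (le_max_right _ _)) (le_max_right _ _)⟩
  -- `u₁ ∗ u = (u ∗ u)'` vanishes on `(b, ∞)` as well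
  have hb₁ : EqOn (⇑(u₁ * u)) 0 (Ioi b) := eqOn_Ioi_of_hasDerivAt (hasDerivAt_mul_left hd u) hb
  -- constants
  set m : ℝ := (‖u x₁‖ / 2) ^ 2 * (2 * δ) with hm
  have hm0 : 0 < m := by positivity
  set K₀ : ℝ := 2 * normSqInt (u * u) + 2 * normSqInt (u₁ * u) with hK₀
  have hK₀0 : 0 ≤ K₀ := by
    have := normSqInt_nonneg (u * u); have := normSqInt_nonneg (u₁ * u); positivity
  set κ : ℝ := 4 * (x₁ - δ) - 2 * b with hκ
  have hκ0 : 0 < κ := by linarith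
  set C : ℝ := 4 * R * K₀ with hC
  have hC0 : 0 ≤ C := by positivity
  -- the key inequality `e^{κ ξ} m² ≤ C ξ²` for every `ξ ≥ 1`
  have key : ∀ ξ : ℝ, 1 ≤ ξ → Real.exp (κ * ξ) * m ^ 2 ≤ C * ξ ^ 2 := by
    intro ξ hξ
    have hξ0 : 0 ≤ ξ := by linarith
    set U : ConvFun := mulExp ξ u with hU
    set U₁ : ConvFun := mulExp ξ ((ξ : ℂ) • u + u₁) with hU₁
    have hdU : ∀ x, HasDerivAt (⇑U) (U₁ x) x := hasDerivAt_mulExp hd ξ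
    set F : ConvFun := U * til U with hF
    set F₁ : ConvFun := U₁ * til U with hF₁
    have hdF : ∀ x, HasDerivAt (⇑F) (F₁ x) x := hasDerivAt_mul_left hdU (til U)
    -- (a) `F 0 = ∫ |U|²`
    have ha : F 0 = ((normSqInt U : ℝ) : ℂ) := mul_til_apply_zero U
    -- (b) lower bound
    have hlb : Real.exp (ξ * (x₁ - δ)) ^ 2 * m ≤ normSqInt U :=
      normSqInt_mulExp_ge hδ (by positivity) hξ0 hlow
    -- (c) `|F 0| ≤ ∫ |F₁|`
    have hc := norm_apply_zero_le hdF
    -- (d) Cauchy–Schwarz on the band `[−2R, 2R]`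
    have hsF₁ : SuppIn F₁ (-(2 * R)) (2 * R) := by
      have h1 : SuppIn U₁ (-R) R := ((hRu.smul (ξ : ℂ)).add hRu₁).mulExp ξ
      have h2 : SuppIn (til U) (-R) R := suppIn_til (hRu.mulExp ξ)
      exact (h1.mul h2 (by linarith) (by linarith)).mono (by linarith) (by linarith)
    have hd' := sq_integral_norm_le (by positivity : 0 < 2 * R) hsF₁
    -- (e) Lemma 4.3.4 and the upper bound
    have he : normSqInt F₁ = normSqInt (U₁ * U) := normSqInt_mul_til U₁ U
    have hw : U₁ * U = mulExp ξ ((ξ : ℂ) • (u * u) + u₁ * u) := by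
      rw [hU₁, hU, ← mulExp_mul, add_mul, smul_mul_assoc]
    have hw0 : EqOn (⇑((ξ : ℂ) • (u * u) + u₁ * u)) 0 (Ioi b) :=
      eqOn_Ioi_add (eqOn_Ioi_smul hb _) hb₁
    have he' : normSqInt (U₁ * U) ≤ Real.exp (ξ * b) ^ 2 * (ξ ^ 2 * K₀) := by
      rw [hw]
      refine (normSqInt_mulExp_le hξ0 hw0).trans ?_
      exact mul_le_mul_of_nonneg_left (normSqInt_smul_add_le _ _ hξ) (by positivity)
    -- combine
    have h2 : (normSqInt U) ^ 2 = ‖F 0‖ ^ 2 := by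
      rw [ha, Complex.norm_real, Real.norm_eq_abs, abs_of_nonneg (normSqInt_nonneg U)]
    have h4 : (Real.exp (ξ * (x₁ - δ)) ^ 2 * m) ^ 2 ≤
        2 * (2 * R) * (Real.exp (ξ * b) ^ 2 * (ξ ^ 2 * K₀)) :=
      calc (Real.exp (ξ * (x₁ - δ)) ^ 2 * m) ^ 2 ≤ (normSqInt U) ^ 2 :=
            pow_le_pow_left₀ (by positivity) hlb 2
        _ = ‖F 0‖ ^ 2 := h2
        _ ≤ (∫ x, ‖F₁ x‖) ^ 2 := pow_le_pow_left₀ (norm_nonneg _) hc 2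
        _ ≤ 2 * (2 * R) * normSqInt F₁ := hd'
        _ = 2 * (2 * R) * normSqInt (U₁ * U) := by rw [he]
        _ ≤ 2 * (2 * R) * (Real.exp (ξ * b) ^ 2 * (ξ ^ 2 * K₀)) :=
            mul_le_mul_of_nonneg_left he' (by positivity)
    have e1 : ∀ a : ℝ, Real.exp a ^ 2 = Real.exp (2 * a) := fun a => by
      rw [sq, ← Real.exp_add]; ring_nf
    have hexp : (Real.exp (ξ * (x₁ - δ)) ^ 2 * m) ^ 2 =
        Real.exp (κ * ξ) * m ^ 2 * Real.exp (ξ * b) ^ 2 := by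
      rw [mul_pow, e1, e1, e1, mul_right_comm, ← Real.exp_add, hκ]
      ring_nf
    rw [hexp] at h4
    have h5 : Real.exp (κ * ξ) * m ^ 2 * Real.exp (ξ * b) ^ 2 ≤
        C * ξ ^ 2 * Real.exp (ξ * b) ^ 2 := by
      rw [hC]; linarith
    exact le_of_mul_le_mul_right h5 (by positivity)
  -- contradiction for large `ξ`, from `e^{κξ} ≥ (κξ)³/6`
  set ξ : ℝ := max 1 (6 * C / (κ ^ 3 * m ^ 2) + 1) with hξdef
  have hξ1 : 1 ≤ ξ := le_max_left _ _
  have hξ0 : 0 < ξ := by linarith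
  have h1 := key ξ hξ1
  have h2 : (κ * ξ) ^ 3 / 6 ≤ Real.exp (κ * ξ) := by
    have := Real.pow_div_factorial_le_exp (x := κ * ξ) (by positivity) 3
    norm_num [Nat.factorial] at this
    exact this
  have h3 : (κ * ξ) ^ 3 / 6 * m ^ 2 ≤ C * ξ ^ 2 :=
    (mul_le_mul_of_nonneg_right h2 (sq_nonneg m)).trans h1
  have h4 : κ ^ 3 * m ^ 2 * ξ * ξ ^ 2 ≤ 6 * C * ξ ^ 2 := by nlinarith [h3]
  have h5 : κ ^ 3 * m ^ 2 * ξ ≤ 6 * C := le_of_mul_le_mul_right h4 (by positivity)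
  have h6 : ξ ≤ 6 * C / (κ ^ 3 * m ^ 2) := by
    rw [le_div_iff₀ (by positivity)]; linarith
  have h7 : 6 * C / (κ ^ 3 * m ^ 2) + 1 ≤ ξ := le_max_right _ _
  linarith

/-! ### §3. The special case (4.3.7) for continuous `u` (regularisation) -/

/-- The mollifying bumps: smooth, supported in `(−1/(n+1), 1/(n+1))`. [folklore] -/
def bump (n : ℕ) : ContDiffBump (0 : ℝ) :=
  ⟨1 / (2 * ((n : ℝ) + 1)), 1 / ((n : ℝ) + 1), by positivity,
    one_div_lt_one_div_of_lt (by positivity) (by linarith)⟩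

/-- The outer radius of `bump n` is `1/(n+1)`. [folklore] -/
theorem bump_rOut (n : ℕ) : (bump n).rOut = 1 / ((n : ℝ) + 1) := rfl

/-- The normalised mollifier `φ_n` (total mass `1`) as an element of `C_c(ℝ, ℂ)`. [folklore] -/
def moll (n : ℕ) : ConvFun :=
  ConvFun.mk (fun x => (((bump n).normed volume x : ℝ) : ℂ))
    (Complex.continuous_ofReal.comp (bump n).continuous_normed)
    ((bump n).hasCompactSupport_normed.comp_left Complex.ofReal_zero)

/-- `φ_n(x)` is the real bump value. [folklore] -/
@[simp] theorem moll_apply (n : ℕ) (x : ℝ) :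
    moll n x = (((bump n).normed volume x : ℝ) : ℂ) := rfl

/-- The derivative `φ_n'` as an element of `C_c(ℝ, ℂ)`. [folklore] -/
def dmoll (n : ℕ) : ConvFun :=
  ConvFun.mk (fun x => ((deriv ((bump n).normed volume) x : ℝ) : ℂ))
    (Complex.continuous_ofReal.comp
      (((bump n).contDiff_normed (n := 1)).continuous_deriv le_rfl))
    (((bump n).hasCompactSupport_normed (μ := volume)).deriv.comp_left Complex.ofReal_zero)

/-- `φ_n' ` is the derivative of `φ_n`. [folklore] -/
theorem hasDerivAt_moll (n : ℕ) (x : ℝ) : HasDerivAt (⇑(moll n)) (dmoll n x) x :=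
  ((((bump n).contDiff_normed (n := 1)).differentiable one_ne_zero) x).hasDerivAt.ofReal_comp

/-- `φ_n = 0` on `(1/(n+1), ∞)`. [folklore] -/
theorem eqOn_Ioi_moll (n : ℕ) : EqOn (⇑(moll n)) 0 (Ioi (1 / ((n : ℝ) + 1))) := by
  intro x hx
  have hx' : 1 / ((n : ℝ) + 1) < x := hx
  have h0 : (bump n).normed volume x = 0 := by
    rw [← Function.notMem_support, (bump n).support_normed_eq, Metric.mem_ball, dist_zero_right,
      Real.norm_eq_abs, not_lt, bump_rOut]
    exact hx'.le.trans (le_abs_self x)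
  rw [moll_apply, h0]; simp

/-- **Mollification converges pointwise**: `(φ_n ∗ u)(x) → u(x)` (Mathlib's
`ContDiffBump.convolution_tendsto_right_of_continuous`). [folklore] -/
theorem tendsto_moll_mul_apply (u : ConvFun) (x : ℝ) :
    Tendsto (fun n => (moll n * u) x) atTop (𝓝 (u x)) := by
  have hφ : Tendsto (fun n => (bump n).rOut) atTop (𝓝 0) := by
    simp only [bump_rOut]
    exact tendsto_one_div_add_atTop_nhds_zero_nat
  have h := ContDiffBump.convolution_tendsto_right_of_continuous (μ := volume) hφ u.continuous x
  refine h.congr fun n => ?_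
  rw [mul_apply, convolution_def]
  refine integral_congr_ae (Eventually.of_forall fun t => ?_)
  simp only [moll_apply, ContinuousLinearMap.lsmul_apply, Complex.real_smul]

/-- **The special case (4.3.7) of the theorem of supports, sup end, for continuous `u`**:
`u ∗ u = 0` on `(b, ∞)` implies `u = 0` on `(b/2, ∞)`; equivalently
`2 sup supp u ≤ sup supp (u ∗ u)`. Reduced to the `C¹` case by mollification (first paragraph
of Hörmander's proof): `(φ_n ∗ u) ∗ (φ_n ∗ u) = (φ_n ∗ φ_n) ∗ (u ∗ u)` vanishes on
`(b + 2/(n+1), ∞)`, so `φ_n ∗ u = 0` on `(b/2 + 1/(n+1), ∞)`, and `φ_n ∗ u → u` pointwise.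
[cite: HormanderALPDO1, Thm. 4.3.3, (4.3.7)] -/
theorem eqOn_Ioi_of_sq {u : ConvFun} {b : ℝ} (hb : EqOn (⇑(u * u)) 0 (Ioi b)) :
    EqOn u 0 (Ioi (b / 2)) := by
  intro x hx
  have hx' : b / 2 < x := hx
  have hU : ∀ n : ℕ, EqOn (⇑(moll n * u)) 0 (Ioi ((b + 2 * (1 / ((n : ℝ) + 1))) / 2)) := by
    intro n
    apply eqOn_Ioi_of_sq_C1 (u₁ := dmoll n * u)
      (fun y => hasDerivAt_mul_left (hasDerivAt_moll n) u y)
    have h1 : moll n * u * (moll n * u) = (moll n * moll n) * (u * u) := mul_mul_mul_comm _ _ _ _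
    rw [h1]
    have h2 := eqOn_Ioi_mul (eqOn_Ioi_mul (eqOn_Ioi_moll n) (eqOn_Ioi_moll n)) hb
    exact eqOn_Ioi_mono h2 (le_of_eq (by ring))
  have hlim := tendsto_moll_mul_apply u x
  have hev : ∀ᶠ n : ℕ in atTop, (moll n * u) x = 0 := by
    have hpos : 0 < x - b / 2 := by linarith
    have ht : Tendsto (fun n : ℕ => 1 / ((n : ℝ) + 1)) atTop (𝓝 0) :=
      tendsto_one_div_add_atTop_nhds_zero_nat
    filter_upwards [ht.eventually (gt_mem_nhds hpos)] with n hn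
    exact hU n (show (b + 2 * (1 / ((n : ℝ) + 1))) / 2 < x by linarith)
  have hlim0 : Tendsto (fun n => (moll n * u) x) atTop (𝓝 0) :=
    tendsto_const_nhds.congr' (hev.mono fun n hn => hn.symm)
  exact tendsto_nhds_unique hlim hlim0

/-- The special case, two-sided vanishing form: if `u ∗ u = 0` on every half-line `(c, ∞)` then
`u = 0`. [folklore] -/
theorem eq_zero_of_sq_eq_zero {u : ConvFun} (h : u * u = 0) : u = 0 :=
  eq_zero_of_forall_eqOn_Ioi fun a =>
    (eqOn_Ioi_of_sq (b := 2 * a) (by rw [h]; exact eqOn_Ioi_zero _)).mono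
      (by rw [mul_div_cancel_left₀ a two_ne_zero])

/-! ### §4. The `K_j` argument: from `u ∗ v` to `(x^a u) ∗ (x^b v)` -/

/-- `x · 0 = 0`. [folklore] -/
@[simp] theorem mulX_zero : mulX 0 = 0 := by
  ext x; simp

/-- The mixed terms `T a b = (x^a u) ∗ (x^b v)` (Hörmander's `(p₁u₁) ∗ (p₂u₂)` with monomials
`p₁ = x^a`, `p₂ = x^b`). [cite: HormanderALPDO1, proof of Thm. 4.3.3] -/
def T (u v : ConvFun) (a b : ℕ) : ConvFun := xpow a u * xpow b v

/-- Symmetry `T_{u,v}(a,b) = T_{v,u}(b,a)`. [folklore] -/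
theorem T_comm (u v : ConvFun) (a b : ℕ) : T u v a b = T v u b a := mul_comm _ _

/-- `T(0,0) = u ∗ v`. [folklore] -/
@[simp] theorem T_zero_zero (u v : ConvFun) : T u v 0 0 = u * v := by simp [T]

/-- **Leibniz**: `x · T(a,b) = T(a+1,b) + T(a,b+1)`. [cite: HormanderALPDO1, proof of Thm. 4.3.3] -/
theorem mulX_T (u v : ConvFun) (a b : ℕ) :
    mulX (T u v a b) = T u v (a + 1) b + T u v a (b + 1) := by
  simp only [T, mulX_mul, xpow_succ]

/-- **The identity behind (4.3.9)**:
`T(a+1,b) ∗ T(a+1,b) = T(a+1,b) ∗ (x·T(a,b)) − T(a,b) ∗ T(a+1,b+1)`, using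
`((q₁u₁)∗(q₂u₂)) ∗ ((p₁u₁)∗(p₂u₂)) = ((q₁u₁)∗(p₂u₂)) ∗ ((p₁u₁)∗(q₂u₂))`.
[cite: HormanderALPDO1, proof of Thm. 4.3.3, (4.3.9)] -/
theorem T_succ_sq (u v : ConvFun) (a b : ℕ) :
    T u v (a + 1) b * T u v (a + 1) b =
      T u v (a + 1) b * mulX (T u v a b) - T u v a b * T u v (a + 1) (b + 1) := by
  have h1 : T u v (a + 1) b = mulX (T u v a b) - T u v a (b + 1) := by
    rw [mulX_T, add_sub_cancel_right]
  have h2 : T u v (a + 1) b * T u v a (b + 1) = T u v a b * T u v (a + 1) (b + 1) := by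
    simp only [T]
    rw [mul_mul_mul_comm, mul_mul_mul_comm (xpow a u) (xpow b v),
      mul_comm (xpow (a + 1) u) (xpow a u)]
  rw [← h2, ← mul_sub, ← h1]

/-- **The convexity step (4.3.8)**: if `T(a,b) = 0` on `(c₁, ∞)` and `T(a+1,b) = T(a+1,b+1) = 0`
on `(c₃, ∞)`, then `T(a+1,b) ∗ T(a+1,b)` vanishes on `(c₁ + c₃, ∞)`, hence (special case (4.3.7))
`T(a+1,b) = 0` on `((c₁ + c₃)/2, ∞)`. [cite: HormanderALPDO1, proof of Thm. 4.3.3, (4.3.8)] -/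
theorem eqOn_Ioi_T_succ {u v : ConvFun} {a b : ℕ} {c₁ c₃ : ℝ}
    (h₁ : EqOn (⇑(T u v a b)) 0 (Ioi c₁)) (h₂ : EqOn (⇑(T u v (a + 1) b)) 0 (Ioi c₃))
    (h₃ : EqOn (⇑(T u v (a + 1) (b + 1))) 0 (Ioi c₃)) :
    EqOn (⇑(T u v (a + 1) b)) 0 (Ioi ((c₁ + c₃) / 2)) := by
  apply eqOn_Ioi_of_sq
  rw [T_succ_sq]
  exact eqOn_Ioi_sub
    (eqOn_Ioi_mono (eqOn_Ioi_mul h₂ (eqOn_Ioi_mulX h₁)) (le_of_eq (add_comm c₃ c₁)))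
    (eqOn_Ioi_mul h₁ h₃)

/-- Degenerate case of the convexity step: `T(a,b) = 0` forces `T(a+1,b) = 0`. [folklore] -/
theorem T_succ_eq_zero {u v : ConvFun} {a b : ℕ} (h : T u v a b = 0) : T u v (a + 1) b = 0 := by
  apply eq_zero_of_sq_eq_zero
  rw [T_succ_sq, h, mulX_zero, mul_zero, zero_mul, sub_zero]

/-- **Degenerate case `u ∗ v = 0`**: then every `T(a,b) = (x^a u) ∗ (x^b v)` vanishes
(induction on `a + b`; in the printed proof, `K_0 = ∅` forces `K_j = ∅`). [folklore] -/
theorem T_eq_zero_of_mul_eq_zero {u v : ConvFun} (h : u * v = 0) :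
    ∀ n a b, a + b = n → T u v a b = 0 := by
  intro n
  induction n with
  | zero =>
    intro a b hab
    obtain ⟨rfl, rfl⟩ : a = 0 ∧ b = 0 := ⟨by omega, by omega⟩
    rw [T_zero_zero]; exact h
  | succ n ih =>
    intro a b hab
    cases a with
    | zero =>
      cases b with
      | zero => exact absurd hab (by omega)
      | succ b =>
        rw [T_comm]
        exact T_succ_eq_zero (by rw [← T_comm]; exact ih 0 b (by omega))
    | succ a => exact T_succ_eq_zero (ih a b (by omega))

/-- **A bounded, non-decreasing, midpoint-convex real sequence is constant** (the step
"`H_{j+k} ≥ H_{j-1} + (k+1)(H_j − H_{j-1})`, hence `H_j = H_{j-1}`" of the printed proof).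
[cite: HormanderALPDO1, proof of Thm. 4.3.3] -/
theorem const_of_convex_bdd {σ : ℕ → ℝ} {M : ℝ} (hmono : ∀ j, σ j ≤ σ (j + 1))
    (hbdd : ∀ j, σ j ≤ M) (hconv : ∀ j, 2 * σ (j + 1) ≤ σ j + σ (j + 2)) : ∀ j, σ j = σ 0 := by
  have hd : ∀ j k, σ (j + 1) - σ j ≤ σ (j + k + 1) - σ (j + k) := by
    intro j k
    induction k with
    | zero => simp
    | succ k ih =>
      have := hconv (j + k)
      rw [show j + (k + 1) + 1 = j + k + 2 by ring, show j + (k + 1) = j + k + 1 by ring]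
      linarith
  by_contra hne
  push Not at hne
  obtain ⟨j₀, hj₀⟩ := hne
  have hex : ∃ j, σ j < σ (j + 1) := by
    by_contra hall
    push Not at hall
    have : ∀ j, σ j = σ 0 := fun j => by
      induction j with
      | zero => rfl
      | succ j ih => exact le_antisymm ((hall j).trans ih.le) (ih.ge.trans (hmono j))
    exact hj₀ (this j₀)
  obtain ⟨j, hj⟩ := hex
  set d := σ (j + 1) - σ j with hd_def
  have hdpos : 0 < d := by linarith
  have hgrow : ∀ k : ℕ, σ j + k * d ≤ σ (j + k) := by
    intro k
    induction k with
    | zero => simp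
    | succ k ih =>
      have := hd j k
      push_cast
      rw [show j + (k + 1) = j + k + 1 by ring]
      linarith
  obtain ⟨k, hk⟩ := exists_nat_gt ((M - σ j) / d)
  have h1 := hgrow k
  have h2 := hbdd (j + k)
  have hk' : M - σ j < k * d := by rwa [div_lt_iff₀ hdpos] at hk
  linarith

section LevelSets

variable (u v : ConvFun)

/-- The level sets `S_j = ⋃_{a+b ≤ j} supp T(a,b)` (Hörmander's `K_j` before taking convex hulls).
[cite: HormanderALPDO1, proof of Thm. 4.3.3] -/
def levelSet (j : ℕ) : Set ℝ :=
  ⋃ p ∈ {p : ℕ × ℕ | p.1 + p.2 ≤ j}, Function.support (⇑(T u v p.1 p.2))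

/-- `σ_j = sup S_j` (the right end-point of Hörmander's `K_j`; a genuine supremum when
`u ∗ v ≠ 0`). [cite: HormanderALPDO1, proof of Thm. 4.3.3] -/
def sigma (j : ℕ) : ℝ := sSup (levelSet u v j)

variable {u v}

/-- Membership in a level set. [folklore] -/
theorem mem_levelSet {j : ℕ} {x : ℝ} :
    x ∈ levelSet u v j ↔ ∃ a b : ℕ, a + b ≤ j ∧ T u v a b x ≠ 0 := by
  constructor
  · intro hx
    simp only [levelSet, mem_iUnion, mem_setOf_eq, Function.mem_support, exists_prop,
      Prod.exists] at hx
    obtain ⟨a, b, hab, hx⟩ := hx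
    exact ⟨a, b, hab, hx⟩
  · rintro ⟨a, b, hab, hx⟩
    simp only [levelSet, mem_iUnion, mem_setOf_eq, Function.mem_support, exists_prop, Prod.exists]
    exact ⟨a, b, hab, hx⟩

/-- Level sets increase with the level. [folklore] -/
theorem levelSet_mono {j k : ℕ} (hjk : j ≤ k) : levelSet u v j ⊆ levelSet u v k := by
  intro x hx
  obtain ⟨a, b, hab, hx⟩ := mem_levelSet.mp hx
  exact mem_levelSet.mpr ⟨a, b, hab.trans hjk, hx⟩

/-- `supp (u ∗ v) ⊆ S_j`. [folklore] -/
theorem support_subset_levelSet (j : ℕ) : Function.support (⇑(u * v)) ⊆ levelSet u v j :=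
  fun x hx => mem_levelSet.mpr ⟨0, 0, by omega, by rwa [T_zero_zero]⟩

/-- Level sets are uniformly bounded above. [folklore] -/
theorem exists_levelSet_subset_Iic : ∃ M : ℝ, ∀ j, levelSet u v j ⊆ Iic M := by
  obtain ⟨R₁, h₁, h₁'⟩ := exists_suppIn u
  obtain ⟨R₂, h₂, h₂'⟩ := exists_suppIn v
  refine ⟨R₁ + R₂, fun j x hx => ?_⟩
  obtain ⟨a, b, -, hx⟩ := mem_levelSet.mp hx
  have ha : SuppIn (xpow a u) (-R₁) R₁ := fun y hy => h₁' y (right_ne_zero_of_mul hy)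
  have hb : SuppIn (xpow b v) (-R₂) R₂ := fun y hy => h₂' y (right_ne_zero_of_mul hy)
  exact ((ha.mul hb (by linarith) (by linarith)) x hx).2

variable (huv : u * v ≠ 0)
include huv

/-- For `u ∗ v ≠ 0` the level sets are non-empty. [folklore] -/
theorem levelSet_nonempty (j : ℕ) : (levelSet u v j).Nonempty := by
  obtain ⟨x, hx⟩ := exists_ne_zero huv
  exact ⟨x, support_subset_levelSet j hx⟩

omit huv in
/-- The level sets are bounded above. [folklore] -/
theorem bddAbove_levelSet (j : ℕ) : BddAbove (levelSet u v j) := by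
  obtain ⟨M, hM⟩ := exists_levelSet_subset_Iic (u := u) (v := v)
  exact ⟨M, fun x hx => hM j hx⟩

omit huv in
/-- Every `T(a,b)` of level `≤ j` vanishes on `(σ_j, ∞)`. [folklore] -/
theorem eqOn_Ioi_T_sigma {j a b : ℕ} (hab : a + b ≤ j) :
    EqOn (⇑(T u v a b)) 0 (Ioi (sigma u v j)) := by
  intro x hx
  by_contra hne
  have hx' : x ≤ sigma u v j := le_csSup (bddAbove_levelSet j) (mem_levelSet.mpr ⟨a, b, hab, hne⟩)
  exact absurd hx (not_lt.mpr hx')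

/-- `σ_j ≤ σ_{j+1}`. [folklore] -/
theorem sigma_mono (j : ℕ) : sigma u v j ≤ sigma u v (j + 1) :=
  csSup_le_csSup (bddAbove_levelSet (j + 1)) (levelSet_nonempty huv j) (levelSet_mono (by omega))

/-- The `σ_j` are uniformly bounded. [folklore] -/
theorem exists_sigma_le : ∃ M : ℝ, ∀ j, sigma u v j ≤ M := by
  obtain ⟨M, hM⟩ := exists_levelSet_subset_Iic (u := u) (v := v)
  exact ⟨M, fun j => csSup_le (levelSet_nonempty huv j) fun x hx => hM j hx⟩

/-- **(4.3.8): `2σ_{j+1} ≤ σ_j + σ_{j+2}`.**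
[cite: HormanderALPDO1, proof of Thm. 4.3.3, (4.3.8)] -/
theorem sigma_convex (j : ℕ) : 2 * sigma u v (j + 1) ≤ sigma u v j + sigma u v (j + 2) := by
  set m : ℝ := (sigma u v j + sigma u v (j + 2)) / 2 with hm
  suffices h : sigma u v (j + 1) ≤ m by linarith
  refine csSup_le (levelSet_nonempty huv (j + 1)) fun x hx => ?_
  obtain ⟨a, b, hab, hx⟩ := mem_levelSet.mp hx
  -- it suffices that `T(a,b)` vanishes on `(m, ∞)`
  suffices hT : EqOn (⇑(T u v a b)) 0 (Ioi m) by
    by_contra hxm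
    exact hx (hT (not_le.mp hxm))
  have hσ02 : sigma u v j ≤ sigma u v (j + 2) :=
    (sigma_mono huv j).trans (sigma_mono huv (j + 1))
  cases a with
  | zero =>
    cases b with
    | zero =>
      exact eqOn_Ioi_mono (eqOn_Ioi_T_sigma (j := j) (by omega)) (by rw [hm]; linarith)
    | succ b =>
      -- symmetric case: swap the roles of `u` and `v`
      have huv' : v * u ≠ 0 := by rwa [mul_comm]
      have e : ∀ a b, T u v a b = T v u b a := fun a b => T_comm u v a b
      rw [e]
      refine eqOn_Ioi_T_succ (u := v) (v := u) (c₁ := sigma u v j) (c₃ := sigma u v (j + 2))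
        ?_ ?_ ?_
      · rw [← e]; exact eqOn_Ioi_T_sigma (by omega)
      · rw [← e]; exact eqOn_Ioi_mono (eqOn_Ioi_T_sigma (j := j + 1) (by omega)) (sigma_mono huv _)
      · rw [← e]; exact eqOn_Ioi_T_sigma (by omega)
  | succ a =>
    refine eqOn_Ioi_T_succ (c₁ := sigma u v j) (c₃ := sigma u v (j + 2)) ?_ ?_ ?_
    · exact eqOn_Ioi_T_sigma (by omega)
    · exact eqOn_Ioi_mono (eqOn_Ioi_T_sigma (j := j + 1) (by omega)) (sigma_mono huv _)
    · exact eqOn_Ioi_T_sigma (by omega)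

/-- **`σ_j = σ_0` for all `j`** (the `K_j = K_0` conclusion).
[cite: HormanderALPDO1, proof of Thm. 4.3.3] -/
theorem sigma_eq_sigma_zero (j : ℕ) : sigma u v j = sigma u v 0 := by
  obtain ⟨M, hM⟩ := exists_sigma_le huv
  exact const_of_convex_bdd (sigma_mono huv) hM (sigma_convex huv) j

end LevelSets

/-- **From `u ∗ v` to all `(x^a u) ∗ (x^b v)`**: if `u ∗ v = 0` on `(s, ∞)` then
`(x^a u) ∗ (x^b v) = 0` on `(s, ∞)` for all `a, b` (Hörmander: `supp (p₁u₁) ∗ (p₂u₂) ⊂ K_0` for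
all polynomials). [cite: HormanderALPDO1, proof of Thm. 4.3.3] -/
theorem eqOn_Ioi_xpow_mul_xpow {u v : ConvFun} {s : ℝ} (h : EqOn (⇑(u * v)) 0 (Ioi s)) (a b : ℕ) :
    EqOn (⇑(xpow a u * xpow b v)) 0 (Ioi s) := by
  change EqOn (⇑(T u v a b)) 0 (Ioi s)
  by_cases huv : u * v = 0
  · rw [T_eq_zero_of_mul_eq_zero huv (a + b) a b rfl]; exact eqOn_Ioi_zero s
  · have h0 : sigma u v 0 ≤ s := by
      refine csSup_le (levelSet_nonempty huv 0) fun x hx => ?_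
      obtain ⟨a', b', hab, hx⟩ := mem_levelSet.mp hx
      obtain ⟨rfl, rfl⟩ : a' = 0 ∧ b' = 0 := ⟨by omega, by omega⟩
      rw [T_zero_zero] at hx
      by_contra hxs
      exact hx (h (not_le.mp hxs))
    have h1 := eqOn_Ioi_T_sigma (u := u) (v := v) (j := a + b) (a := a) (b := b) le_rfl
    rw [sigma_eq_sigma_zero huv] at h1
    exact eqOn_Ioi_mono h1 h0

/-! ### §5. Conclusion: vanishing moments, Weierstrass, assembly -/

/-- **A continuous compactly supported real function with vanishing polynomial moments is zero**
(Weierstrass approximation on an interval containing the support; replaces the heat-kernel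
limit `p_j = E(x − x_j, t)`, `t ↘ 0`, of the printed proof). [folklore] -/
theorem eq_zero_of_forall_integral_polynomial_mul {ψ : ℝ → ℝ} (hc : Continuous ψ)
    (hs : HasCompactSupport ψ) (h : ∀ p : Polynomial ℝ, ∫ t, p.eval t * ψ t = 0) (x : ℝ) :
    ψ x = 0 := by
  obtain ⟨R, -, hsub⟩ := hs.isCompact.isBounded.subset_closedBall_lt 0 (0 : ℝ)
  have hψ0 : ∀ t, t ∉ Icc (-R) R → ψ t = 0 := by
    intro t ht
    apply image_eq_zero_of_notMem_tsupport
    intro h'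
    apply ht
    have := hsub h'
    rw [Metric.mem_closedBall, dist_zero_right, Real.norm_eq_abs, abs_le] at this
    exact this
  have hint : Integrable ψ volume := hc.integrable_of_hasCompactSupport hs
  have hsq_supp : HasCompactSupport fun t => ψ t ^ 2 :=
    hs.comp_left (g := fun r : ℝ => r ^ 2) (by simp)
  have hsq_int : Integrable (fun t => ψ t ^ 2) volume :=
    (hc.pow 2).integrable_of_hasCompactSupport hsq_supp
  set I := ∫ t, ψ t ^ 2 with hI
  set J := ∫ t, |ψ t| with hJ
  have hJ0 : 0 ≤ J := integral_nonneg fun _ => abs_nonneg _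
  -- `I ≤ ε J` for every `ε > 0`, by Weierstrass approximation of `ψ` on `[−R, R]`
  have hle : ∀ ε : ℝ, 0 < ε → I ≤ ε * J := by
    intro ε hε
    obtain ⟨p, hp⟩ := exists_polynomial_near_of_continuousOn (-R) R ψ hc.continuousOn ε hε
    have hp_int : Integrable (fun t => p.eval t * ψ t) volume :=
      (p.continuous.mul hc).integrable_of_hasCompactSupport hs.mul_left
    have hd_int : Integrable (fun t => (ψ t - p.eval t) * ψ t) volume :=
      ((hc.sub p.continuous).mul hc).integrable_of_hasCompactSupport hs.mul_left
    have h1 : I = ∫ t, (ψ t - p.eval t) * ψ t := by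
      have : ∫ t, (ψ t - p.eval t) * ψ t = (∫ t, ψ t ^ 2) - ∫ t, p.eval t * ψ t := by
        rw [← integral_sub hsq_int hp_int]
        exact integral_congr_ae (Eventually.of_forall fun t => by ring)
      rw [this, h p, sub_zero]
    rw [h1]
    calc ∫ t, (ψ t - p.eval t) * ψ t ≤ ∫ t, ε * |ψ t| := by
          refine integral_mono hd_int (hint.abs.const_mul ε) fun t => ?_
          dsimp only
          by_cases ht : t ∈ Icc (-R) R
          · have h2 : |ψ t - p.eval t| ≤ ε := by rw [abs_sub_comm]; exact (hp t ht).le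
            calc (ψ t - p.eval t) * ψ t ≤ |(ψ t - p.eval t) * ψ t| := le_abs_self _
              _ = |ψ t - p.eval t| * |ψ t| := abs_mul _ _
              _ ≤ ε * |ψ t| := mul_le_mul_of_nonneg_right h2 (abs_nonneg _)
          · rw [hψ0 t ht]; simp
      _ = ε * J := integral_const_mul _ _
  have hI0 : I ≤ 0 := by
    refine le_of_forall_pos_le_add fun ε hε => ?_
    have := hle (ε / (J + 1)) (by positivity)
    have hJ1 : ε / (J + 1) * J ≤ ε := by
      rw [div_mul_eq_mul_div, div_le_iff₀ (by positivity)]; nlinarith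
    linarith
  by_contra hx
  have hpos : 0 < I :=
    (hc.pow 2).integral_pos_of_hasCompactSupport_nonneg_nonzero hsq_supp (fun t => sq_nonneg _)
      (pow_ne_zero 2 hx)
  linarith

/-- **`sup supp u + sup supp v ≤ sup supp (u ∗ v)`, point-wise form**: if `u ∗ v = 0` on
`(s, ∞)`, `u(t₁) ≠ 0` and `v(t₂) ≠ 0`, then `t₁ + t₂ ≤ s`. Otherwise, with `x = t₁ + t₂ > s`, all
moments `∫ tᵃ u(t) v(x − t) dt = ((xᵃu) ∗ v)(x)` vanish (§4), so `t ↦ u(t) v(x − t)` vanishes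
identically, contradicting its value at `t₁` (last paragraph of the printed proof).
[cite: HormanderALPDO1, Thm. 4.3.3] -/
theorem add_le_of_eqOn_Ioi {u v : ConvFun} {s : ℝ} (h : EqOn (⇑(u * v)) 0 (Ioi s)) {t₁ t₂ : ℝ}
    (h₁ : u t₁ ≠ 0) (h₂ : v t₂ ≠ 0) : t₁ + t₂ ≤ s := by
  by_contra hlt
  push Not at hlt
  set x := t₁ + t₂ with hx
  set φ : ℝ → ℂ := fun t => u t * v (x - t) with hφ
  have hφc : Continuous φ := u.continuous.mul (v.continuous.comp (continuous_sub_left x))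
  have hφs : HasCompactSupport φ := u.hasCompactSupport.mul_right
  -- all monomial moments of `φ` vanish
  have hmom : ∀ a : ℕ, ∫ t : ℝ, ((t : ℝ) : ℂ) ^ a * φ t = 0 := by
    intro a
    have := eqOn_Ioi_xpow_mul_xpow h a 0 hlt
    rw [xpow_zero, mul_apply] at this
    simp only [xpow_apply, mul_assoc, Pi.zero_apply] at this
    exact this
  -- hence all polynomial moments
  have hpint : ∀ p : Polynomial ℝ, Integrable (fun t : ℝ => ((p.eval t : ℝ) : ℂ) * φ t) volume :=
      fun p =>
    ((Complex.continuous_ofReal.comp p.continuous).mul hφc).integrable_of_hasCompactSupport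
      hφs.mul_left
  have hpoly : ∀ p : Polynomial ℝ, ∫ t : ℝ, ((p.eval t : ℝ) : ℂ) * φ t = 0 := by
    intro p
    induction p using Polynomial.induction_on' with
    | add p q hp hq =>
      simp only [Polynomial.eval_add, Complex.ofReal_add, add_mul]
      rw [integral_add (hpint p) (hpint q), hp, hq, add_zero]
    | monomial n c =>
      simp only [Polynomial.eval_monomial, Complex.ofReal_mul, Complex.ofReal_pow, mul_assoc]
      rw [integral_const_mul, hmom n, mul_zero]
  -- real and imaginary parts
  have hre : ∀ p : Polynomial ℝ, ∫ t, p.eval t * (φ t).re = 0 := by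
    intro p
    have h2 := integral_re (hpint p)
    rw [hpoly p] at h2
    simpa only [RCLike.re_to_complex, Complex.re_ofReal_mul, map_zero] using h2
  have him : ∀ p : Polynomial ℝ, ∫ t, p.eval t * (φ t).im = 0 := by
    intro p
    have h2 := integral_im (hpint p)
    rw [hpoly p] at h2
    simpa only [RCLike.im_to_complex, Complex.im_ofReal_mul, map_zero] using h2
  have hre0 := eq_zero_of_forall_integral_polynomial_mul (Complex.continuous_re.comp hφc)
    (hφs.comp_left Complex.zero_re) hre t₁
  have him0 := eq_zero_of_forall_integral_polynomial_mul (Complex.continuous_im.comp hφc)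
    (hφs.comp_left Complex.zero_im) him t₁
  have hφ0 : φ t₁ = 0 := Complex.ext hre0 him0
  have hφ1 : φ t₁ = u t₁ * v t₂ := by
    simp only [hφ, hx, add_sub_cancel_left]
  rw [hφ1] at hφ0
  exact mul_ne_zero h₁ h₂ hφ0

/-- **Non-zero factors have non-zero convolution** (`C_c(ℝ)` under convolution is an integral
domain — Titchmarsh). [cite: Titchmarsh1926, Thm. VII] -/
theorem mul_ne_zero_of_ne_zero {u v : ConvFun} (hu : u ≠ 0) (hv : v ≠ 0) : u * v ≠ 0 := by
  intro huv
  obtain ⟨t₁, h₁⟩ := exists_ne_zero hu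
  obtain ⟨t₂, h₂⟩ := exists_ne_zero hv
  have := add_le_of_eqOn_Ioi (s := t₁ + t₂ - 1) (by rw [huv]; exact eqOn_Ioi_zero _) h₁ h₂
  linarith

/-- **Theorem of supports, sup end**: `sup supp (u ∗ v) = sup supp u + sup supp v` for non-zero
`u, v ∈ C_c(ℝ, ℂ)`. [cite: HormanderALPDO1, Thm. 4.3.3] [cite: Titchmarsh1926, Thm. VII] -/
theorem sSup_support_mul {u v : ConvFun} (hu : u ≠ 0) (hv : v ≠ 0) :
    sSup (Function.support (⇑(u * v))) =
      sSup (Function.support (⇑u)) + sSup (Function.support (⇑v)) := by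
  have huv := mul_ne_zero_of_ne_zero hu hv
  obtain ⟨t₁, h₁⟩ := exists_ne_zero hu
  obtain ⟨t₂, h₂⟩ := exists_ne_zero hv
  obtain ⟨x₀, hx₀⟩ := exists_ne_zero huv
  set s := sSup (Function.support (⇑(u * v))) with hs
  have hvan : EqOn (⇑(u * v)) 0 (Ioi s) := by
    intro x hx
    by_contra hne
    exact absurd (le_csSup (bddAbove_support _) hne) (not_le.mpr hx)
  apply le_antisymm
  · refine csSup_le ⟨x₀, hx₀⟩ fun x hx => ?_
    have hx' : x ∈ Function.support ((u : ℝ → ℂ) ⋆[ConvFun.L, volume] (v : ℝ → ℂ)) := hx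
    obtain ⟨a, ha, b, hb, rfl⟩ := support_convolution_subset ConvFun.L hx'
    exact add_le_add (le_csSup (bddAbove_support u) ha) (le_csSup (bddAbove_support v) hb)
  · have key : ∀ a ∈ Function.support (⇑u), ∀ b ∈ Function.support (⇑v), a + b ≤ s :=
      fun a ha b hb => add_le_of_eqOn_Ioi hvan ha hb
    have h1 : sSup (Function.support (⇑u)) ≤ s - sSup (Function.support (⇑v)) := by
      refine csSup_le ⟨t₁, h₁⟩ fun a ha => ?_
      have : sSup (Function.support (⇑v)) ≤ s - a :=
        csSup_le ⟨t₂, h₂⟩ fun b hb => by linarith [key a ha b hb]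
      linarith
    linarith

/-- Reflection `ǔ(x) = u(−x)`. [folklore] -/
def refl (u : ConvFun) : ConvFun :=
  ConvFun.mk (fun x => u (-x)) (u.continuous.comp continuous_neg)
    (HasCompactSupport.intro u.hasCompactSupport.isCompact.neg fun x hx =>
      image_eq_zero_of_notMem_tsupport fun h => hx (by simpa using h))

/-- `ǔ(x) = u(−x)`. [folklore] -/
@[simp] theorem refl_apply (u : ConvFun) (x : ℝ) : refl u x = u (-x) := rfl

/-- `(u ∗ v)ˇ = ǔ ∗ v̌`. [folklore] -/
theorem refl_mul (u v : ConvFun) : refl (u * v) = refl u * refl v := by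
  ext x
  rw [refl_apply, mul_apply, mul_apply,
    ← integral_neg_eq_self (fun t => refl u t * refl v (x - t)) volume]
  refine integral_congr_ae (Eventually.of_forall fun t => ?_)
  dsimp only
  have h : -(x - -t) = -x - t := by ring
  rw [refl_apply, refl_apply, neg_neg, h]

/-- `supp ǔ = − supp u`. [folklore] -/
theorem support_refl (u : ConvFun) : Function.support (⇑(refl u)) = -Function.support (⇑u) := by
  ext x; simp

/-- `u ≠ 0 ⟹ ǔ ≠ 0`. [folklore] -/
theorem refl_ne_zero {u : ConvFun} (hu : u ≠ 0) : refl u ≠ 0 := by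
  intro h
  apply hu
  ext x
  have := congrArg (fun w : ConvFun => w (-x)) h
  simpa using this

/-- **Theorem of supports, inf end**: `inf supp (u ∗ v) = inf supp u + inf supp v` for non-zero
`u, v ∈ C_c(ℝ, ℂ)` (from the sup end by reflection). [cite: HormanderALPDO1, Thm. 4.3.3]
[cite: Titchmarsh1926, Thm. VII] -/
theorem sInf_support_mul {u v : ConvFun} (hu : u ≠ 0) (hv : v ≠ 0) :
    sInf (Function.support (⇑(u * v))) =
      sInf (Function.support (⇑u)) + sInf (Function.support (⇑v)) := by
  have h := sSup_support_mul (refl_ne_zero hu) (refl_ne_zero hv)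
  rw [← refl_mul, support_refl, support_refl, support_refl, Real.sSup_neg, Real.sSup_neg,
    Real.sSup_neg] at h
  linarith

end Titchmarsh1926

open Literature.Analysis.Convolution Titchmarsh1926 in
/-- **The theorem of supports** (Titchmarsh 1926, Thm. VII, `n = 1`; Lions 1951; Hörmander
Thm. 4.3.3: `ch supp u₁ ∗ u₂ = ch supp u₁ + ch supp u₂`), for continuous compactly supported
`f, g : ℝ → ℂ`, both `≢ 0`: the convolution `x ↦ ∫ f(t) g(x − t) dt` satisfies
`inf supp = inf supp f + inf supp g` and `sup supp = sup supp f + sup supp g`. DISCHARGES the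
named fact `Titchmarsh1926_convolution_support`, following Hörmander's real-variable proof
(module docstring). [cite: HormanderALPDO1, Thm. 4.3.3] [cite: Titchmarsh1926, Thm. VII] -/
theorem Titchmarsh1926_convolution_support_holds : Titchmarsh1926_convolution_support := by
  intro f g hf hg hfs hgs hf0 hg0
  set u : ConvFun := ConvFun.mk f hf hfs with hu
  set v : ConvFun := ConvFun.mk g hg hgs with hv
  have hu0 : u ≠ 0 := fun h => hf0 (by
    funext x
    have := congrArg (fun w : ConvFun => w x) h
    exact this)
  have hv0 : v ≠ 0 := fun h => hg0 (by
    funext x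
    have := congrArg (fun w : ConvFun => w x) h
    exact this)
  have hconv : (fun x => ∫ t, f t * g (x - t)) = ⇑(u * v) := by
    funext x; rw [ConvFun.mul_apply]; rfl
  rw [hconv]
  exact ⟨sInf_support_mul hu0 hv0, sSup_support_mul hu0 hv0⟩

end Literature.Analysis.Fourier
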